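import Summits.QuantumFields.YangMills.Theorems.BalabanUVNodesN17ShiftModulusCrossoverU2Fading
import Summits.QuantumFields.BalabanUV.T4Continuum.Spine.NE4.FadingFromRateAnalyticSharp

/-!
# NODE N17 (NE4) → THE N19′ CORE EDGE OF K3⁷ — WITNESS MODULE for PARTS 2–3: the binder sets of the family theorems under a scale-shift MODULUS are
# JOINTLY INHABITED, non-degenerately — explicitly by scale-dependent history-FLAT families (exact discrepancies), and WITH NONZERO FADING MEMORY by a
# history-dependent family whose runs come from forward shooting (A2 ∕ A6 certificate; answers ref-N g5 READ-41 row 128)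

Cell `pub-ymgap`, YM-PLAN Track A (HUMAN RULING D-0062 ∕ D-0149), WIDTH SEAT `pub-ymgap-dag-n17-w2` (gen 5), key K3⁷ stmt-QuantumFields-20544
(`--kind proof --supports 20544 --as helper`, COUNT-NEUTRAL).  Trigger (t1) of the lineage: referee ref-N g5 READ-41 (row 128, PART 3 `…CrossoverU2Fading` p599524:
PASS · NOT-A-DISCHARGE) records «A2: inhabitation NOT exhibited although the prose says "every antecedent inhabited by the geometric instance (§4) and the tree's toy
runs" (§4 is a conditional theorem inhabiting only the envelope letters; no witness decl named)».  Correct — PART 3 §4 (and PART 2 §4) discharge the ENVELOPE ∕ MODULUS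
letters only; the RUN letters (`RGEqH`, box, pin), the β letters (shift modulus, `HistLipschitz` ∕ `LastOnlyLipschitz`, `FadingMemory`, `EventualLowerH`) and the smallness
stayed hypotheses, and no decl in the tree inhabits them together.  THIS MODULE NAMES THE WITNESSES.

WHAT THIS FILE PROVES (theorems only; 0 `def`, 0 `instance`, 0 `notation`, 0 `sorry`; witnesses written as explicit terms or characterised by their values).
§1 HISTORY-FLAT FAMILIES `β k v = t_k` (`t ≥ 0`) ARE EXACTLY SOLVABLE: `g^{(K)}_k := (1∕g_IR² + Σ_{i∈[k,K)} t_i)^{−1∕2}` is a run of (0.20) of every length `K` (`rgEqH_flatRun`),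
inside `]0, g_IR] ⊆ ]0,γ]` (`box_flatRun`), IR-pinned (`pin_flatRun`); the injected discrepancy of two consecutive runs is EXACTLY the summed scale shift,
`disc (g^{(K)}) (g^{(K+1)}) j = |Σ_{i∈[j,K)} (t_i − t_{i+1})|` (`disc_flatRun_eq`); zero history moduli (`histLipschitz_flat`, `lastOnlyLipschitz_flat`, `fadingMemory_zero`),
shift `|t_{k+1} − t_k|` (`shift_flat`), floors (`eventualLowerH_flat`).
§2 THE SCALE-DEPENDENT INSTANCE `t_k = b + c·θ^k`: NE4's shape `ScaleShiftRate (c(1−θ)) θ γ` holds WITH EQUALITY (`scaleShiftRate_scaleFlat` — a nonzero geometric rate), the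
shift modulus `μ_k = c(1−θ)θ^k` is summable with tails `Σ'_i μ_{i+j} = c·θ^j` (`tsum_tail_shift_scaleFlat`), and ★★ `disc_scaleFlat_eq`: `disc (g^{(K)}) (g^{(K+1)}) j = c·(θ^j − θ^K)`
— NONZERO for `c > 0`, `j < K`.
§3 ★ INHABITATION BY NAME, every antecedent discharged, nothing assumed but numeric ranges (`0 < b`, `0 ≤ c`, `0 < θ < 1`, `0 < g_IR ≤ γ`, the theorem's own smallness):
`inhabits_injectedModulus_lastOnly` (PART 2 §3; bound `e^{2L(γ³+2γ∕b)}·c·θ^j` against the exact `c(θ^j − θ^K)`: at `L = 0` PART 2's injected modulus `E·TAIL_j(μ)` is ATTAINED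
as `K → ∞` — the last-only Grönwall bound is SHARP on the flat family), `inhabits_injectedModulus_fadingMemory` (PART 3 §3, envelope `(c+1)θ^j`, `κ = 1`, `Λ ≡ 0`),
`inhabits_crossover_fadingMemory` (PART 3 §4), `inhabits_crossover_lastOnly` (PART 2 §4), and the all-numerals instance `inhabits_crossover_fadingMemory_numeric`
(`b = c = γ = g_IR = 1`, `θ = a = 1∕2`, `C = 1∕12` — smallness with equality —, `Λ = 2`).
§4 ★★★ `exists_histDep_inhabitant_fadingMemory` — WITH GENUINE MEMORY: the history-DEPENDENT family `β k v = b + c·θ^k + ε·tower θ k v`, `tower θ k v = Σ_{i≤k} θ^{k−i}·v_i` the geometric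
tower of `Spine.NE4.FadingFromRateAnalyticSharp` (cell pub-balaban-gaps' witness for the COMPLEX∕analytic NE4 shapes — reused BY NAME, its `sum_pow_sub_le` too) (continuous, `b ≤ β ≤ b + c + εγ∕(1−θ)`
on the boxes — `tower_bounds`, `continuousOn_histDep`) has history moduli `Λ k i = ε·θ^{k−i} > 0` (`histLipschitz_histDep`), fading memory with constant `ε`, the exact
scale shift `cθ^{k+1} − cθ^k + ε·θ^{k+1}·w₀` (`tower_shift` ∕ `shift_histDep`: the memory sums telescope under `Fin.tail` up to the weight of the extra FINEST coupling), hence the modulus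
`(c(1−θ) + εγθ)·θ^k`; its IR-pinned runs of every length exist inside `]0,γ]` by FORWARD SHOOTING (`FlowStep.couplingTrajectory_exists_history`, the tree's reduction of
[Balaban1987RG1] Thm 2); with `ε` AT the smallness threshold `ε·(γ³ + 2γ∕b) = (1−θ)∕2` EVERY antecedent of PART 3 §3 `injectedModulus_of_runs_fadingMemory_shiftModulus` holds —
the statement lists them in the theorem's order (`κ = 1`, `k₀ = 0`) together with `0 < C` and `0 < Λ k i` — and so does its conclusion for these runs.

WHAT IT SAYS (LOCATED).  (i) The binder sets of PART 2 §3–§4 and PART 3 §3–§4 are jointly satisfiable, with a nonzero injected source and (PART 3) nonzero memory: the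
family theorems are not vacuous (A2), and no hidden joint inconsistency of the kind director-ym №189 found elsewhere (A6) sits in them.  (ii) On history-flat data the
whole two-run machinery collapses to the identity `disc = |summed scale shift|` — the content of nodes U2 ∕ N17 is ENTIRELY in the history dependence and in the smallness
that tames it; PART 2's constant is optimal there.  (iii) Nothing is inhabited AT BAŁABAN's β: the witnesses are artificial families of the typed SHAPE `HBeta`.

HONEST SCOPE (A6, director-ym №189).  Elementary real analysis ([folklore]) over hypothesis SHAPES plus ONE tree reduction BY NAME (`couplingTrajectory_exists_history`);
nothing of Bałaban asserted or instantiated; NE4 ∕ `HistLipschitz` ∕ `FadingMemory` ∕ `EventualLowerH` NOT PRINTED as used ([Balaban1987RG1] p. 264 «separate paper», §5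
p. 298) and NOT proved for Bałaban's β-functions; no K2⁷ ∕ K3⁷ stub proved; N17 ∕ N19 NOT discharged; K2⁷ ∕ K3⁷ OPEN; counts UNMOVED (typed 28∕28 · discharged 5∕28 =
5∕27 work-bound + NODE O).  One finite four-torus programme at fixed `ε = L^{−K}`, Bałaban AS PRINTED; the YM mass gap (Clay) is NOT proved by any of this — R4 closes the
conditional finite-𝕋⁴ rung `BalabanLadder.UV` only; nothing continuum ∕ ℝ⁴ ∕ OS.
References: [Balaban1987RG1] T. Bałaban, Commun. Math. Phys. **109** (1987), (0.20) p. 256, Thm 2 and (0.31) p. 259, §1 p. 264, §5 p. 298.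
-/

noncomputable section

namespace Summit.QuantumFields.YangMills.BalabanUVNodes.N17ShiftModulusCrossoverWitness

open Literature.MathematicalPhysics.QuantumFieldTheory.Balaban1983to89
open Literature.MathematicalPhysics.QuantumFieldTheory.Balaban1983to89.FlowStep
open Literature.MathematicalPhysics.QuantumFieldTheory.Balaban1983to89.T4CouplingMatching
open Summit.QuantumFields.YangMills.BalabanUVNodes.N17ShiftModulusCrossoverU2
  (injectedModulus_of_runs_lastOnly_shiftModulus summable_crossover_of_runs_lastOnly_scaleShiftRate)
open Summit.QuantumFields.YangMills.BalabanUVNodes.N17ShiftModulusCrossoverU2Fading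
  (injectedModulus_of_runs_fadingMemory_shiftModulus summable_crossover_of_runs_fadingMemory_scaleShiftRate)
open Summit.QuantumFields.BalabanUV.T4Continuum.Spine.NE4 (tower sum_pow_sub_le)
open Finset

/-! ## §1 History-FLAT families `β k v = t k` are exactly solvable: explicit IR-pinned runs of every length -/

/-- the explicit runs of a history-flat family: `1∕(g^{(K)}_k)² = 1∕g_IR² + Σ_{i∈[k,K)} t_i` — the inverse square is the displayed sum. [folklore] -/
theorem invSq_flatRun {t : ℕ → ℝ} {gIR : ℝ} (hIR : 0 < gIR) (ht : ∀ k, 0 ≤ t k) (K k : ℕ) :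
    1 / ((Real.sqrt (1 / gIR ^ 2 + ∑ i ∈ Ico k K, t i))⁻¹) ^ 2 = 1 / gIR ^ 2 + ∑ i ∈ Ico k K, t i := by
  have hQ : 0 ≤ 1 / gIR ^ 2 + ∑ i ∈ Ico k K, t i := add_nonneg (by positivity) (Finset.sum_nonneg fun i _ => ht i)
  rw [inv_pow, Real.sq_sqrt hQ, one_div, inv_inv]

/-- ★ history-flat families solve (0.20) explicitly: for `β k v := t k` (`t ≥ 0`) and every IR value `g_IR > 0`, the sequence
`g^{(K)}_k := (1∕g_IR² + Σ_{i∈[k,K)} t_i)^{−1∕2}` is a run of `RGEqH K` (history-independent β: the two-point problem is a backward sum). [cite: Balaban1987RG1, (0.20) p.256] -/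
theorem rgEqH_flatRun {t : ℕ → ℝ} {gIR : ℝ} (hIR : 0 < gIR) (ht : ∀ k, 0 ≤ t k) (K : ℕ) :
    RGEqH K (fun k _ => t k) (fun k => (Real.sqrt (1 / gIR ^ 2 + ∑ i ∈ Ico k K, t i))⁻¹) := by
  intro k hk
  simp only [invSq_flatRun hIR ht]
  rw [Finset.sum_eq_sum_Ico_succ_bot hk]
  ring

/-- the runs lie in the printed box: `0 < g^{(K)}_k ≤ g_IR ≤ γ` (the inverse square only grows towards the ultraviolet). [cite: Balaban1987RG1, Thm 2 p.259] -/
theorem box_flatRun {t : ℕ → ℝ} {gIR γ : ℝ} (hIR : 0 < gIR) (hIRγ : gIR ≤ γ) (ht : ∀ k, 0 ≤ t k) (K k : ℕ) :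
    0 < (Real.sqrt (1 / gIR ^ 2 + ∑ i ∈ Ico k K, t i))⁻¹ ∧ (Real.sqrt (1 / gIR ^ 2 + ∑ i ∈ Ico k K, t i))⁻¹ ≤ γ := by
  have hA : 0 < 1 / gIR ^ 2 := by positivity
  have hS : 0 ≤ ∑ i ∈ Ico k K, t i := Finset.sum_nonneg fun i _ => ht i
  have hQ : 0 < 1 / gIR ^ 2 + ∑ i ∈ Ico k K, t i := by linarith
  refine ⟨inv_pos.mpr (Real.sqrt_pos.mpr hQ), ?_⟩
  have h1 : Real.sqrt (1 / gIR ^ 2) ≤ Real.sqrt (1 / gIR ^ 2 + ∑ i ∈ Ico k K, t i) := Real.sqrt_le_sqrt (by linarith)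
  have h2 : Real.sqrt (1 / gIR ^ 2) = gIR⁻¹ := by
    rw [one_div, ← inv_pow, Real.sqrt_sq (inv_nonneg.mpr hIR.le)]
  calc (Real.sqrt (1 / gIR ^ 2 + ∑ i ∈ Ico k K, t i))⁻¹ ≤ (Real.sqrt (1 / gIR ^ 2))⁻¹ :=
        inv_anti₀ (by rw [h2]; exact inv_pos.mpr hIR) h1
    _ = gIR := by rw [h2, inv_inv]
    _ ≤ γ := hIRγ

/-- the runs are IR-pinned at one value: `g^{(K)}_K = g_IR` for every `K`. [folklore] -/
theorem pin_flatRun {t : ℕ → ℝ} {gIR : ℝ} (hIR : 0 < gIR) (K : ℕ) :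
    (fun k => (Real.sqrt (1 / gIR ^ 2 + ∑ i ∈ Ico k K, t i))⁻¹) K = gIR := by
  simp only [Finset.Ico_self, Finset.sum_empty, add_zero]
  rw [one_div, ← inv_pow, Real.sqrt_sq (inv_nonneg.mpr hIR.le), inv_inv]

/-- ★ THE INJECTED DISCREPANCY OF TWO CONSECUTIVE FLAT RUNS, EXACTLY: for every `j`,
`disc (g^{(K)}) (g^{(K+1)}) j = |Σ_{i∈[j,K)} (t_i − t_{i+1})|` — the discrepancy IS the summed scale shift of the family (no smallness, no memory). [folklore] -/
theorem disc_flatRun_eq {t : ℕ → ℝ} {gIR : ℝ} (hIR : 0 < gIR) (ht : ∀ k, 0 ≤ t k) (K j : ℕ) :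
    disc (fun k => (Real.sqrt (1 / gIR ^ 2 + ∑ i ∈ Ico k K, t i))⁻¹)
        (fun k => (Real.sqrt (1 / gIR ^ 2 + ∑ i ∈ Ico k (K + 1), t i))⁻¹) j = |∑ i ∈ Ico j K, (t i - t (i + 1))| := by
  simp only [disc, invSq_flatRun hIR ht]
  rw [← Finset.sum_Ico_add' t j K 1, Finset.sum_sub_distrib]
  congr 1
  ring

/-- a history-flat family has NO history dependence: `HistLipschitz` holds with the ZERO modulus. [folklore] -/
theorem histLipschitz_flat (t : ℕ → ℝ) (γ : ℝ) : HistLipschitz (fun _ _ => 0) γ (fun k _ => t k) := by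
  intro k p q _ _
  simp

/-- … and `LastOnlyLipschitz L` for every `L ≥ 0`. [folklore] -/
theorem lastOnlyLipschitz_flat (t : ℕ → ℝ) (γ : ℝ) {L : ℝ} (hL : 0 ≤ L) : LastOnlyLipschitz L γ (fun k _ => t k) := by
  intro k p q _ _
  simpa using mul_nonneg hL (abs_nonneg (p (Fin.last k) - q (Fin.last k)))

/-- the zero modulus has fading memory at every rate: `FadingMemory C θ 0` for `C, θ ≥ 0`. [folklore] -/
theorem fadingMemory_zero {C θ : ℝ} (hC : 0 ≤ C) (hθ : 0 ≤ θ) : FadingMemory C θ (fun _ _ => 0) :=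
  fun _ _ _ => ⟨le_rfl, mul_nonneg hC (pow_nonneg hθ _)⟩

/-- the scale shift of a flat family is `|t_{k+1} − t_k|`, at every history. [folklore] -/
theorem shift_flat (t : ℕ → ℝ) (k : ℕ) (w : Fin (k + 2) → ℝ) :
    |(fun k (_ : Fin (k + 1) → ℝ) => t k) (k + 1) w - (fun k (_ : Fin (k + 1) → ℝ) => t k) k (Fin.tail w)| = |t (k + 1) - t k| := rfl

/-- an eventual floor of the increments is an eventual asymptotic-freedom floor of the family: `(∀ k ≥ k₀, b ≤ t_k) → EventualLowerH b γ k₀`. [folklore] -/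
theorem eventualLowerH_flat {t : ℕ → ℝ} {b : ℝ} {k₀ : ℕ} (γ : ℝ) (h : ∀ k, k₀ ≤ k → b ≤ t k) :
    EventualLowerH b γ k₀ (fun k _ => t k) := fun k _ hk _ => h k hk

/-! ## §2 The scale-dependent flat family `β k v = b + c·θ^k`: geometric scale shift, geometric tails, and the EXACT injected discrepancy -/

/-- the scale shift of `t_k = b + c·θ^k` is `|t_{k+1} − t_k| = c(1−θ)·θ^k` (`c ≥ 0`, `0 ≤ θ ≤ 1`). [folklore] -/
theorem shift_scaleFlat {b c θ : ℝ} (hc : 0 ≤ c) (hθ0 : 0 ≤ θ) (hθ1 : θ ≤ 1) (k : ℕ) :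
    |(b + c * θ ^ (k + 1)) - (b + c * θ ^ k)| = c * (1 - θ) * θ ^ k := by
  rw [abs_sub_comm, abs_of_nonneg] <;> nlinarith [pow_nonneg hθ0 k, mul_nonneg hc (pow_nonneg hθ0 k), pow_succ θ k]

/-- ★ NE4's SHAPE IS INHABITED WITH A NONZERO RATE: the family `β k v := b + c·θ^k` has `ScaleShiftRate (c(1−θ)) θ γ` — with EQUALITY at every history
(so for `c > 0`, `θ < 1` no smaller constant works). [folklore] -/
theorem scaleShiftRate_scaleFlat {b c θ : ℝ} (γ : ℝ) (hc : 0 ≤ c) (hθ0 : 0 ≤ θ) (hθ1 : θ ≤ 1) :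
    ScaleShiftRate (c * (1 - θ)) θ γ (fun k _ => b + c * θ ^ k) := by
  intro k w _
  exact (shift_scaleFlat (b := b) hc hθ0 hθ1 k).le

/-- the shift modulus `μ_k = c(1−θ)θ^k` is summable … [folklore] -/
theorem summable_shift_scaleFlat (c : ℝ) {θ : ℝ} (hθ0 : 0 ≤ θ) (hθ1 : θ < 1) : Summable fun k => c * (1 - θ) * θ ^ k :=
  (summable_geometric_of_lt_one hθ0 hθ1).mul_left _

/-- … with tails `Σ'_i μ_{i+j} = c·θ^j` exactly. [folklore] -/
theorem tsum_tail_shift_scaleFlat (c : ℝ) {θ : ℝ} (hθ0 : 0 ≤ θ) (hθ1 : θ < 1) (j : ℕ) :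
    ∑' i, c * (1 - θ) * θ ^ (i + j) = c * θ ^ j := by
  have h1 : 1 - θ ≠ 0 := by linarith
  simp_rw [pow_add, ← mul_assoc, mul_comm (c * (1 - θ)) _, mul_assoc]
  rw [tsum_mul_right, tsum_geometric_of_lt_one hθ0 hθ1]
  field_simp

/-- ★★ THE INJECTED DISCREPANCY OF THE WITNESS, EXACTLY: for `j ≤ K` the two consecutive IR-pinned runs of `β k v = b + c·θ^k` have
`disc (g^{(K)}) (g^{(K+1)}) j = c·(θ^j − θ^K)` — NONZERO for `c > 0`, `j < K` (the witness is non-degenerate: the source really is injected), `≤ c·θ^j`, and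
`→ c·θ^j` as `K → ∞`. [folklore] -/
theorem disc_scaleFlat_eq {b c θ gIR : ℝ} (hb : 0 ≤ b) (hc : 0 ≤ c) (hθ0 : 0 ≤ θ) (hθ1 : θ < 1) (hIR : 0 < gIR) {K j : ℕ} (hj : j ≤ K) :
    disc (fun k => (Real.sqrt (1 / gIR ^ 2 + ∑ i ∈ Ico k K, (b + c * θ ^ i)))⁻¹)
        (fun k => (Real.sqrt (1 / gIR ^ 2 + ∑ i ∈ Ico k (K + 1), (b + c * θ ^ i)))⁻¹) j = c * (θ ^ j - θ ^ K) := by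
  have ht : ∀ k, 0 ≤ b + c * θ ^ k := fun k => add_nonneg hb (mul_nonneg hc (pow_nonneg hθ0 k))
  rw [disc_flatRun_eq hIR ht K j]
  have hsum : ∑ i ∈ Ico j K, ((b + c * θ ^ i) - (b + c * θ ^ (i + 1))) = c * (θ ^ j - θ ^ K) := by
    have e : ∀ i ∈ Ico j K, ((b + c * θ ^ i) - (b + c * θ ^ (i + 1))) = c * (1 - θ) * θ ^ i := fun i _ => by ring
    rw [Finset.sum_congr rfl e, ← Finset.mul_sum, geom_sum_Ico (by linarith) hj]
    have h1 : θ - 1 ≠ 0 := by linarith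
    field_simp
    ring
  rw [hsum]
  exact abs_of_nonneg (mul_nonneg hc (sub_nonneg.mpr (pow_le_pow_of_le_one hθ0 hθ1.le hj)))

/-! ## §3 ★ INHABITATION BY NAME: every antecedent of PART 2 §3–§4 and PART 3 §3–§4 discharged at the witness, nothing assumed but numeric ranges -/

/-- ★★ **PART 2's family theorem `injectedModulus_of_runs_lastOnly_shiftModulus` IS INHABITED** — at `β k v := b + c·θ^k`, runs
`g^{(K)}_k = (1∕g_IR² + Σ_{i∈[k,K)}(b + cθ^i))^{−1∕2}`, `μ_k = c(1−θ)θ^k`, `k₀ = 0`, any `L ≥ 0` with `L·γ³ ≤ 1∕2`: EVERY antecedent holds (runs `rgEqH_flatRun`, box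
`box_flatRun`, pin `pin_flatRun`, shift `scaleShiftRate_scaleFlat`, `lastOnlyLipschitz_flat`, `eventualLowerH_flat`, `summable_shift_scaleFlat`), so its conclusion holds
there: `disc ≤ e^{2L(γ³+2γ∕b)}·c·θ^j`.  With `disc_scaleFlat_eq`: at `L = 0` the bound reads `c(θ^j − θ^K) ≤ c·θ^j` — PART 2's injected modulus `E·TAIL_j(μ)` is ATTAINED in the
limit `K → ∞`; the last-only Grönwall bound is sharp on the flat family. [folklore] -/
theorem inhabits_injectedModulus_lastOnly {b c θ gIR γ L : ℝ} (hb : 0 < b) (hc : 0 ≤ c) (hθ0 : 0 ≤ θ) (hθ1 : θ < 1)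
    (hIR : 0 < gIR) (hIRγ : gIR ≤ γ) (hL0 : 0 ≤ L) (hLγ : L * γ ^ 3 ≤ 1 / 2) :
    ∀ K j : ℕ, j ≤ K →
      0 ≤ disc (fun k => (Real.sqrt (1 / gIR ^ 2 + ∑ i ∈ Ico k K, (b + c * θ ^ i)))⁻¹)
            (fun k => (Real.sqrt (1 / gIR ^ 2 + ∑ i ∈ Ico k (K + 1), (b + c * θ ^ i)))⁻¹) j ∧
        disc (fun k => (Real.sqrt (1 / gIR ^ 2 + ∑ i ∈ Ico k K, (b + c * θ ^ i)))⁻¹)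
            (fun k => (Real.sqrt (1 / gIR ^ 2 + ∑ i ∈ Ico k (K + 1), (b + c * θ ^ i)))⁻¹) j
          ≤ Real.exp (2 * (L * (γ ^ 3 + 2 * γ / b))) * (c * θ ^ j) := by
  have hγ : 0 < γ := hIR.trans_le hIRγ
  have ht : ∀ k, 0 ≤ b + c * θ ^ k := fun k => add_nonneg hb.le (mul_nonneg hc (pow_nonneg hθ0 k))
  have h := injectedModulus_of_runs_lastOnly_shiftModulus (β := fun k _ => b + c * θ ^ k) (k₀ := 0) (μ := fun k => c * (1 - θ) * θ ^ k)
    (fun K k => (Real.sqrt (1 / gIR ^ 2 + ∑ i ∈ Ico k K, (b + c * θ ^ i)))⁻¹) gIR hγ hb hL0 hLγ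
    (fun K => rgEqH_flatRun hIR ht K) (fun K i _ => box_flatRun hIR hIRγ ht K i) (fun K => pin_flatRun hIR K)
    (scaleShiftRate_scaleFlat γ hc hθ0 hθ1.le) (lastOnlyLipschitz_flat _ γ hL0) (eventualLowerH_flat γ fun k _ => by nlinarith [pow_nonneg hθ0 k])
    (summable_shift_scaleFlat c hθ0 hθ1)
  intro K j hj
  have hKj := h K j hj
  rw [tsum_tail_shift_scaleFlat c hθ0 hθ1 j] at hKj
  simpa using hKj

/-- ★★ **PART 3's family theorem `injectedModulus_of_runs_fadingMemory_shiftModulus` IS INHABITED** — at the same family and runs, history moduli `Λ ≡ 0`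
(`histLipschitz_flat`; fading memory at every rate, `fadingMemory_zero`), envelope `x_j = (c+1)·θ^j` (positive, antitone, θ-regular with `κ = 1`, above the tails
`c·θ^j` = `tsum_tail_shift_scaleFlat`), `k₀ = 0`, and ANY memory constant `0 ≤ C` under the theorem's own smallness `C·1·((0+1)γ³ + 2γ∕b) ≤ (1−θ)∕2`: every antecedent
holds, so the conclusion `disc ≤ 2(c+1)θ^j` holds there — against the exact value `c(θ^j − θ^K)` (`disc_scaleFlat_eq`).  The memory letters are inhabited at the ZERO
modulus only (history-flat witness); a history-DEPENDENT inhabitant with nonzero fading memory is §4. [folklore] -/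
theorem inhabits_injectedModulus_fadingMemory {b c θ gIR γ C : ℝ} (hb : 0 < b) (hc : 0 ≤ c) (hθ0 : 0 < θ) (hθ1 : θ < 1)
    (hIR : 0 < gIR) (hIRγ : gIR ≤ γ) (hC : 0 ≤ C) (hsmall : C * 1 * ((((0 : ℕ) : ℝ) + 1) * γ ^ 3 + 2 * γ / b) ≤ (1 - θ) / 2) :
    ∀ K j : ℕ, j ≤ K →
      0 ≤ disc (fun k => (Real.sqrt (1 / gIR ^ 2 + ∑ i ∈ Ico k K, (b + c * θ ^ i)))⁻¹)
            (fun k => (Real.sqrt (1 / gIR ^ 2 + ∑ i ∈ Ico k (K + 1), (b + c * θ ^ i)))⁻¹) j ∧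
        disc (fun k => (Real.sqrt (1 / gIR ^ 2 + ∑ i ∈ Ico k K, (b + c * θ ^ i)))⁻¹)
            (fun k => (Real.sqrt (1 / gIR ^ 2 + ∑ i ∈ Ico k (K + 1), (b + c * θ ^ i)))⁻¹) j ≤ 2 * ((c + 1) * θ ^ j) := by
  have hγ : 0 < γ := hIR.trans_le hIRγ
  have ht : ∀ k, 0 ≤ b + c * θ ^ k := fun k => add_nonneg hb.le (mul_nonneg hc (pow_nonneg hθ0.le k))
  have hx : ∀ j, 0 < (c + 1) * θ ^ j := fun j => mul_pos (by linarith) (pow_pos hθ0 j)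
  have hanti : ∀ i j, i ≤ j → (c + 1) * θ ^ j ≤ (c + 1) * θ ^ i := fun i j hij =>
    mul_le_mul_of_nonneg_left (pow_le_pow_of_le_one hθ0.le hθ1.le hij) (by linarith)
  have hreg : ∀ i j, i ≤ j → θ ^ (j - i) * ((c + 1) * θ ^ i) ≤ 1 * ((c + 1) * θ ^ j) := fun i j hij => by
    have e : θ ^ (j - i) * θ ^ i = θ ^ j := by rw [← pow_add, Nat.sub_add_cancel hij]
    nlinarith [e]
  have htail : ∀ j, ∑' i, c * (1 - θ) * θ ^ (i + j) ≤ (c + 1) * θ ^ j := fun j => by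
    rw [tsum_tail_shift_scaleFlat c hθ0.le hθ1 j]; nlinarith [pow_nonneg hθ0.le j]
  exact injectedModulus_of_runs_fadingMemory_shiftModulus (β := fun k _ => b + c * θ ^ k) (k₀ := 0) (μ := fun k => c * (1 - θ) * θ ^ k)
    (x := fun j => (c + 1) * θ ^ j) (Λ := fun _ _ => 0)
    (fun K k => (Real.sqrt (1 / gIR ^ 2 + ∑ i ∈ Ico k K, (b + c * θ ^ i)))⁻¹) gIR hγ hb hθ0.le hθ1 hC
    (fun K => rgEqH_flatRun hIR ht K) (fun K i _ => box_flatRun hIR hIRγ ht K i) (fun K => pin_flatRun hIR K)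
    (scaleShiftRate_scaleFlat γ hc hθ0.le hθ1.le) (histLipschitz_flat _ γ) (fadingMemory_zero hC hθ0.le)
    (eventualLowerH_flat γ fun k _ => by nlinarith [pow_nonneg hθ0.le k]) (summable_shift_scaleFlat c hθ0.le hθ1)
    hx hanti hreg htail hsmall

/-- ★ **PART 3 §4 `summable_crossover_of_runs_fadingMemory_scaleShiftRate` IS INHABITED**: at the witness (NE4's shape with rate `c(1−θ)` at the memory rate `θ`, `Λ ≡ 0`,
`k₀ = 0`, `0 ≤ C` under the tree's smallness) the crossover sums with the ACTUAL injected discrepancies `c(θ^j − θ^K)` are summable over `K` for every contraction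
`0 < a < 1` and multiplicity base `Λ ≥ 0` — the junction with PART 1 is not vacuous. [folklore] -/
theorem inhabits_crossover_fadingMemory {b c θ gIR γ C a Λm : ℝ} (hb : 0 < b) (hc : 0 ≤ c) (hθ0 : 0 < θ) (hθ1 : θ < 1)
    (hIR : 0 < gIR) (hIRγ : gIR ≤ γ) (hC : 0 ≤ C) (hsmall : C * ((((0 : ℕ) : ℝ) + 1) * γ ^ 3 + 2 * γ / b) ≤ (1 - θ) / 2)
    (ha0 : 0 < a) (ha1 : a < 1) (hΛm : 0 ≤ Λm) :
    Summable fun K => ∑ y ∈ antidiagonal K, min (a ^ y.2)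
      (disc (fun k => (Real.sqrt (1 / gIR ^ 2 + ∑ i ∈ Ico k K, (b + c * θ ^ i)))⁻¹)
            (fun k => (Real.sqrt (1 / gIR ^ 2 + ∑ i ∈ Ico k (K + 1), (b + c * θ ^ i)))⁻¹) y.1 * Λm ^ y.2) := by
  have hγ : 0 < γ := hIR.trans_le hIRγ
  have ht : ∀ k, 0 ≤ b + c * θ ^ k := fun k => add_nonneg hb.le (mul_nonneg hc (pow_nonneg hθ0.le k))
  exact summable_crossover_of_runs_fadingMemory_scaleShiftRate (β := fun k _ => b + c * θ ^ k) (k₀ := 0) (Λ := fun _ _ => 0)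
    (fun K k => (Real.sqrt (1 / gIR ^ 2 + ∑ i ∈ Ico k K, (b + c * θ ^ i)))⁻¹) gIR hγ hb hθ0 hθ1 hC
    (fun K => rgEqH_flatRun hIR ht K) (fun K i _ => box_flatRun hIR hIRγ ht K i) (fun K => pin_flatRun hIR K)
    (scaleShiftRate_scaleFlat γ hc hθ0.le hθ1.le) (histLipschitz_flat _ γ) (fadingMemory_zero hC hθ0.le)
    (eventualLowerH_flat γ fun k _ => by nlinarith [pow_nonneg hθ0.le k]) hsmall ha0 ha1 hΛm

/-- ★ **PART 2 §4 `summable_crossover_of_runs_lastOnly_scaleShiftRate` IS INHABITED** (last-only reading, any `L ≥ 0` with `L·γ³ ≤ 1∕2`). [folklore] -/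
theorem inhabits_crossover_lastOnly {b c θ gIR γ L a Λm : ℝ} (hb : 0 < b) (hc : 0 ≤ c) (hθ0 : 0 < θ) (hθ1 : θ < 1)
    (hIR : 0 < gIR) (hIRγ : gIR ≤ γ) (hL0 : 0 ≤ L) (hLγ : L * γ ^ 3 ≤ 1 / 2) (ha0 : 0 < a) (ha1 : a < 1) (hΛm : 0 ≤ Λm) :
    Summable fun K => ∑ y ∈ antidiagonal K, min (a ^ y.2)
      (disc (fun k => (Real.sqrt (1 / gIR ^ 2 + ∑ i ∈ Ico k K, (b + c * θ ^ i)))⁻¹)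
            (fun k => (Real.sqrt (1 / gIR ^ 2 + ∑ i ∈ Ico k (K + 1), (b + c * θ ^ i)))⁻¹) y.1 * Λm ^ y.2) := by
  have hγ : 0 < γ := hIR.trans_le hIRγ
  have ht : ∀ k, 0 ≤ b + c * θ ^ k := fun k => add_nonneg hb.le (mul_nonneg hc (pow_nonneg hθ0.le k))
  exact summable_crossover_of_runs_lastOnly_scaleShiftRate (β := fun k _ => b + c * θ ^ k) (k₀ := 0)
    (fun K k => (Real.sqrt (1 / gIR ^ 2 + ∑ i ∈ Ico k K, (b + c * θ ^ i)))⁻¹) gIR hγ hb hL0 hLγ hθ0 hθ1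
    (fun K => rgEqH_flatRun hIR ht K) (fun K i _ => box_flatRun hIR hIRγ ht K i) (fun K => pin_flatRun hIR K)
    (scaleShiftRate_scaleFlat γ hc hθ0.le hθ1.le) (lastOnlyLipschitz_flat _ γ hL0)
    (eventualLowerH_flat γ fun k _ => by nlinarith [pow_nonneg hθ0.le k]) ha0 ha1 hΛm

/-- THE NUMERIC INSTANCE (all letters numerals): `b = c = γ = g_IR = 1`, `θ = a = 1∕2`, memory constant `C = 1∕12` (smallness `(1∕12)·(1 + 2) = 1∕4 = (1 − 1∕2)∕2`, equality),
multiplicity base `Λ = 2`: the fading-memory crossover of PART 3 §4 is summable at these numbers. [folklore] -/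
theorem inhabits_crossover_fadingMemory_numeric :
    Summable fun K => ∑ y ∈ antidiagonal K, min ((1 / 2 : ℝ) ^ y.2)
      (disc (fun k => (Real.sqrt (1 / (1 : ℝ) ^ 2 + ∑ i ∈ Ico k K, (1 + 1 * (1 / 2 : ℝ) ^ i)))⁻¹)
            (fun k => (Real.sqrt (1 / (1 : ℝ) ^ 2 + ∑ i ∈ Ico k (K + 1), (1 + 1 * (1 / 2 : ℝ) ^ i)))⁻¹) y.1 * (2 : ℝ) ^ y.2) :=
  inhabits_crossover_fadingMemory (C := 1 / 12) one_pos zero_le_one (by norm_num) (by norm_num) one_pos le_rfl (by norm_num)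
    (by norm_num) (by norm_num) (by norm_num) (by norm_num)

/-! ## §4 A history-DEPENDENT inhabitant with NONZERO fading memory: `β k v = b + c·θ^k + ε·tower θ k v` (the geometric tower of `Spine.NE4.FadingFromRateAnalyticSharp`), runs by forward shooting -/

/-- on the box the geometric tower `tower θ k v = Σ_{i≤k} θ^{k−i}·v_i` lies between `0` and `γ∕(1−θ)` (`Spine.NE4.sum_pow_sub_le` BY NAME). [folklore] -/
theorem tower_bounds {θ γ : ℝ} (hθ0 : 0 ≤ θ) (hθ1 : θ < 1) {k : ℕ} {v : Fin (k + 1) → ℝ} (hv : v ∈ Box γ k) :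
    0 ≤ tower θ k v ∧ tower θ k v ≤ γ / (1 - θ) := by
  have hv' := mem_box.mp hv
  refine ⟨Finset.sum_nonneg fun i _ => mul_nonneg (pow_nonneg hθ0 _) (hv' i).1.le, ?_⟩
  have hγ : 0 ≤ γ := (hv' 0).1.le.trans (hv' 0).2
  calc tower θ k v ≤ ∑ i : Fin (k + 1), θ ^ (k - (i : ℕ)) * γ :=
        Finset.sum_le_sum fun i _ => mul_le_mul_of_nonneg_left (hv' i).2 (pow_nonneg hθ0 _)
    _ = (∑ i : Fin (k + 1), θ ^ (k - (i : ℕ))) * γ := by rw [Finset.sum_mul]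
    _ ≤ 1 / (1 - θ) * γ := mul_le_mul_of_nonneg_right (sum_pow_sub_le hθ0 hθ1 k) hγ
    _ = γ / (1 - θ) := by rw [one_div, div_eq_inv_mul]

/-- THE REAL TOWER's SCALE SHIFT, EXACTLY (real companion of `Spine.NE4.towerC_shift`): `tower θ (k+1) w = θ^{k+1}·w₀ + tower θ k (Fin.tail w)` — the memory sums telescope
under `Fin.tail` up to the weight of the extra FINEST coupling `w₀`. [folklore] -/
theorem tower_shift (θ : ℝ) (k : ℕ) (w : Fin (k + 2) → ℝ) :
    tower θ (k + 1) w = θ ^ (k + 1) * w 0 + tower θ k (Fin.tail w) := by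
  simp only [tower]
  rw [Fin.sum_univ_succ]
  simp only [Fin.val_zero, Nat.sub_zero, Fin.val_succ, Nat.succ_sub_succ, Fin.tail]

/-- THE SCALE SHIFT OF THE HISTORY-DEPENDENT FAMILY, EXACTLY (family characterised by its values `hβ`): `β_{k+2}(w) − β_{k+1}(tail w) = cθ^{k+1} − cθ^k + ε·θ^{k+1}·w₀`. [folklore] -/
theorem shift_histDep {β : HBeta} {b c ε θ : ℝ} (hβ : ∀ k v, β k v = b + c * θ ^ k + ε * tower θ k v) (k : ℕ) (w : Fin (k + 2) → ℝ) :
    β (k + 1) w - β k (Fin.tail w) = c * θ ^ (k + 1) - c * θ ^ k + ε * (θ ^ (k + 1) * w 0) := by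
  rw [hβ, hβ, tower_shift]
  ring

/-- the history-dependent family has HISTORY MODULI `Λ k i = ε·θ^{k−i}` — genuinely nonzero fading memory at rate `θ` with constant `ε`. [folklore] -/
theorem histLipschitz_histDep {β : HBeta} {b c ε θ : ℝ} (hβ : ∀ k v, β k v = b + c * θ ^ k + ε * tower θ k v)
    (γ : ℝ) (hε : 0 ≤ ε) (hθ0 : 0 ≤ θ) : HistLipschitz (fun k i => ε * θ ^ (k - i)) γ β := by
  intro k p q _ _
  have e : β k p - β k q = ε * (∑ i : Fin (k + 1), θ ^ (k - (i : ℕ)) * p i - ∑ i : Fin (k + 1), θ ^ (k - (i : ℕ)) * q i) := by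
    rw [hβ, hβ]; simp only [tower]; ring
  rw [e, ← Finset.sum_sub_distrib, Finset.mul_sum]
  refine (Finset.abs_sum_le_sum_abs _ _).trans (le_of_eq (Finset.sum_congr rfl fun i _ => ?_))
  show _ = ε * θ ^ (k - (i : ℕ)) * |p i - q i|
  have hi : ε * (θ ^ (k - (i : ℕ)) * p i - θ ^ (k - (i : ℕ)) * q i) = (ε * θ ^ (k - (i : ℕ))) * (p i - q i) := by ring
  rw [hi, abs_mul, abs_of_nonneg (mul_nonneg hε (pow_nonneg hθ0 _))]

/-- the history-dependent family is CONTINUOUS on every box (affine in the history) — the shooting hypothesis of `FlowStep.couplingTrajectory_exists_history`. [folklore] -/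
theorem continuousOn_histDep {β : HBeta} {b c ε θ : ℝ} (hβ : ∀ k v, β k v = b + c * θ ^ k + ε * tower θ k v)
    (γ : ℝ) (k : ℕ) : ContinuousOn (β k) (Box γ k) := by
  have e : β k = fun v => b + c * θ ^ k + ε * ∑ i : Fin (k + 1), θ ^ (k - (i : ℕ)) * v i := funext fun v => by rw [hβ]; rfl
  rw [e]
  exact (continuous_const.add (continuous_const.mul
    (continuous_finsetSum _ fun i _ => continuous_const.mul (continuous_apply i)))).continuousOn

/-- ★★★ **A HISTORY-DEPENDENT INHABITANT OF PART 3's FAMILY THEOREM, WITH NONZERO FADING MEMORY.**  For every floor `b > 0`, shift constant `c ≥ 0`, rate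
`0 < θ < 1` and IR value `0 < g_IR ≤ γ` there are a history-DEPENDENT family `β k v = b + c·θ^k + ε·Σ_{i≤k} θ^{k−i}·v_i` (memory constant `ε > 0` chosen AT the
smallness threshold `ε·((0+1)γ³ + 2γ∕b) = (1−θ)∕2`), history moduli `Λ k i = ε·θ^{k−i} > 0`, IR-pinned runs `g^{(K)}` of (0.20) of every length inside `]0,γ]` (by forward
shooting, `FlowStep.couplingTrajectory_exists_history`: `β` is continuous with `b ≤ β ≤ b + c + εγ∕(1−θ)` on the boxes), the shift modulus `μ_k = (c(1−θ) + εγθ)·θ^k`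
(`shift_histDep`: the extra finest coupling weighs `ε·θ^{k+1}·w₀`) and the envelope `x_j = (c′+1)θ^j`, `c′(1−θ) = c(1−θ) + εγθ`, such that EVERY antecedent of
`injectedModulus_of_runs_fadingMemory_shiftModulus` holds (listed in the statement in the theorem's order, `κ = 1`, `k₀ = 0`) — hence its conclusion `disc ≤ 2x_j` for these
runs.  The binder set of PART 3 §3 is jointly satisfiable WITH GENUINE MEMORY; nothing here is Bałaban's β. [folklore] -/
theorem exists_histDep_inhabitant_fadingMemory {b c θ gIR γ : ℝ} (hb : 0 < b) (hc : 0 ≤ c) (hθ0 : 0 < θ) (hθ1 : θ < 1)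
    (hIR : 0 < gIR) (hIRγ : gIR ≤ γ) :
    ∃ (β : HBeta) (Λ : ℕ → ℕ → ℝ) (g : ℕ → ℕ → ℝ) (μ x : ℕ → ℝ) (C κ : ℝ),
      0 < C ∧ (∀ k i, i ≤ k → 0 < Λ k i) ∧
      (∀ K, RGEqH K β (g K)) ∧ (∀ K i, i ≤ K → 0 < g K i ∧ g K i ≤ γ) ∧ (∀ K, g K K = gIR) ∧
      (∀ k (w : Fin (k + 2) → ℝ), w ∈ Box γ (k + 1) → |β (k + 1) w - β k (Fin.tail w)| ≤ μ k) ∧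
      HistLipschitz Λ γ β ∧ FadingMemory C θ Λ ∧ EventualLowerH b γ 0 β ∧ Summable μ ∧
      (∀ j, 0 < x j) ∧ (∀ i j, i ≤ j → x j ≤ x i) ∧ (∀ i j, i ≤ j → θ ^ (j - i) * x i ≤ κ * x j) ∧
      (∀ j, ∑' i, μ (i + j) ≤ x j) ∧ C * κ * ((((0 : ℕ) : ℝ) + 1) * γ ^ 3 + 2 * γ / b) ≤ (1 - θ) / 2 ∧
      (∀ K j, j ≤ K → 0 ≤ disc (g K) (g (K + 1)) j ∧ disc (g K) (g (K + 1)) j ≤ 2 * x j) := by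
  have hγ : 0 < γ := hIR.trans_le hIRγ
  have h1θ : 0 < 1 - θ := by linarith
  -- the memory constant, chosen AT the smallness threshold (κ = 1, k₀ = 0)
  have hUpos : 0 < (((0 : ℕ) : ℝ) + 1) * γ ^ 3 + 2 * γ / b := by positivity
  obtain ⟨ε, hεpos, hsmall⟩ : ∃ ε : ℝ, 0 < ε ∧ ε * 1 * ((((0 : ℕ) : ℝ) + 1) * γ ^ 3 + 2 * γ / b) ≤ (1 - θ) / 2 :=
    ⟨(1 - θ) / 2 / ((((0 : ℕ) : ℝ) + 1) * γ ^ 3 + 2 * γ / b), div_pos (by linarith) hUpos,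
      by rw [mul_one, div_mul_cancel₀ _ hUpos.ne']⟩
  -- the family (characterised by its values) and its shift constant `c′`
  obtain ⟨β, hβ⟩ : ∃ β : HBeta, ∀ k v, β k v = b + c * θ ^ k + ε * tower θ k v := ⟨_, fun _ _ => rfl⟩
  obtain ⟨c', hc'0, hc'eq⟩ : ∃ c' : ℝ, 0 ≤ c' ∧ c' * (1 - θ) = c * (1 - θ) + ε * γ * θ :=
    ⟨c + ε * γ * θ / (1 - θ), by positivity, by field_simp⟩
  -- bounds on the boxes, continuity, runs by forward shooting
  have hlo : ∀ k v, v ∈ Box γ k → b ≤ β k v := fun k v hv => by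
    rw [hβ]; nlinarith [pow_nonneg hθ0.le k, mul_nonneg hεpos.le (tower_bounds hθ0.le hθ1 hv).1]
  have hhi : ∀ k v, v ∈ Box γ k → β k v ≤ b + c + ε * (γ / (1 - θ)) := fun k v hv => by
    rw [hβ]
    nlinarith [mul_le_mul_of_nonneg_left (tower_bounds hθ0.le hθ1 hv).2 hεpos.le, mul_le_mul_of_nonneg_left (pow_le_one₀ hθ0.le hθ1.le : θ ^ k ≤ 1) hc]
  have hbβ' : b ≤ b + c + ε * (γ / (1 - θ)) := by nlinarith [mul_nonneg hεpos.le (div_nonneg hγ.le h1θ.le)]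
  have hex := couplingTrajectory_exists_history β hγ hb hbβ' (continuousOn_histDep hβ γ) hlo hhi
  choose g hgK hrg hbox _h031 using fun K => hex K gIR hIR hIRγ
  -- the letters of the theorem, one by one
  have hμ : ∀ k (w : Fin (k + 2) → ℝ), w ∈ Box γ (k + 1) → |β (k + 1) w - β k (Fin.tail w)| ≤ c' * (1 - θ) * θ ^ k := by
    intro k w hw
    have hw0 := (mem_box.mp hw) 0
    have e1 : β (k + 1) w - β k (Fin.tail w) = (ε * θ * w 0 - c * (1 - θ)) * θ ^ k := by rw [shift_histDep hβ]; ring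
    rw [e1, hc'eq, abs_mul, abs_of_nonneg (pow_nonneg hθ0.le k)]
    refine mul_le_mul_of_nonneg_right (abs_le.mpr ⟨?_, ?_⟩) (pow_nonneg hθ0.le k)
    · nlinarith [mul_nonneg (mul_nonneg hεpos.le hθ0.le) hw0.1.le, mul_nonneg (mul_nonneg hεpos.le hγ.le) hθ0.le]
    · nlinarith [mul_le_mul_of_nonneg_left hw0.2 (mul_nonneg hεpos.le hθ0.le), mul_nonneg hc h1θ.le]
  have hx : ∀ j, 0 < (c' + 1) * θ ^ j := fun j => mul_pos (by linarith) (pow_pos hθ0 j)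
  have hanti : ∀ i j, i ≤ j → (c' + 1) * θ ^ j ≤ (c' + 1) * θ ^ i := fun i j hij =>
    mul_le_mul_of_nonneg_left (pow_le_pow_of_le_one hθ0.le hθ1.le hij) (by linarith)
  have hreg : ∀ i j, i ≤ j → θ ^ (j - i) * ((c' + 1) * θ ^ i) ≤ 1 * ((c' + 1) * θ ^ j) := fun i j hij => by
    have e : θ ^ (j - i) * θ ^ i = θ ^ j := by rw [← pow_add, Nat.sub_add_cancel hij]
    nlinarith [e]
  have htail : ∀ j, ∑' i, c' * (1 - θ) * θ ^ (i + j) ≤ (c' + 1) * θ ^ j := fun j => by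
    rw [tsum_tail_shift_scaleFlat c' hθ0.le hθ1 j]; nlinarith [pow_nonneg hθ0.le j]
  have hL : HistLipschitz (fun k i => ε * θ ^ (k - i)) γ β := histLipschitz_histDep hβ γ hεpos.le hθ0.le
  have hF : FadingMemory ε θ (fun k i => ε * θ ^ (k - i)) := fun k i _ => ⟨mul_nonneg hεpos.le (pow_nonneg hθ0.le _), le_rfl⟩
  have hE : EventualLowerH b γ 0 β := fun k v _ hv => hlo k v hv
  refine ⟨β, fun k i => ε * θ ^ (k - i), g, fun k => c' * (1 - θ) * θ ^ k, fun j => (c' + 1) * θ ^ j, ε, 1, hεpos,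
    fun k i _ => mul_pos hεpos (pow_pos hθ0 _), hrg, hbox, hgK, hμ, hL, hF, hE, summable_shift_scaleFlat c' hθ0.le hθ1,
    hx, hanti, hreg, htail, hsmall, ?_⟩
  exact injectedModulus_of_runs_fadingMemory_shiftModulus g gIR hγ hb hθ0.le hθ1 hεpos.le hrg hbox hgK hμ hL hF hE
    (summable_shift_scaleFlat c' hθ0.le hθ1) hx hanti hreg htail hsmall

end Summit.QuantumFields.YangMills.BalabanUVNodes.N17ShiftModulusCrossoverWitness

end
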